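import Literature.NumberTheory.EllipticCurves.Zhai2016.NonvanishingQuadraticTwists
import Literature.NumberTheory.EllipticCurves.BSDSelmerParityDokchitserProofs
import Literature.NumberTheory.EllipticCurves.ComplexMultiplication
import HarnessLib

/-!
# Route `TwoAdicConverse` (rung S3), item 19218 — a SECOND printed (β)-family inside the `r_an = 0` locus:
# Zhai's Neumann–Setzer TWISTS `A^{(−q)}` (Zhai 2016, Asian J. Math. 20, Thm. 1.4)

Cell `bsd-2adic`, seat `bsd-2adic-conv-1` (GEN 23). THEOREMS ONLY — nothing asserted, no definition; route-independent
imports (Literature only). Companion of `TwoAdicConversePrimeConductorTwoTorsion.lean` / `…NeumannSetzerExplicit.lean` (the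
prime-conductor family, Mazur 1977 II (18.10)): the S3 content locus is `{r_an ≥ 2}` (`…ContentLocus.lean`), and the printed
CLASS statements that put a (β)-family (rational `2`-torsion) into `{r_an = 0}` are, to this seat's knowledge, exactly
two — Mazur's (prime conductor) and Zhai's Thm. 1.4 (this file): for `u ≡ 5 (mod 8)` with `p = u² + 64` prime,
`A = Zhai2016.neumannSetzer u` (`y² + xy = x³ + ((u−1)/4)x² + 4x + u`, conductor `p`, `A(ℚ)[2] ≠ 0`) and a prime
`q ≡ 3 (mod 4)` inert in `ℚ(√p)`, every globally minimal model `WM` of the twist `A^{(−q)}` has `L(WM,1) ≠ 0`,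
`A^{(−q)}(ℚ)` finite and `Ш(A^{(−q)})` finite (typed named fact `Zhai2016.thm14_neumannSetzer_twists`, «bsd-p2» p313726;
its BSD₂ content is consumed on the FORMULA axis by `Rank1Residual/P2/CountsAtTwoZhai16.lean`). Here the RANK-axis reading:
`r_an(WM) = 0` and `corank_{ℤ₂} Sel_{2^∞}(WM/ℚ) = 0` (corank `= rank + corank Ш[2^∞] = 0 + 0`, Greenberg §1, tree
`selmerCorank_eq_mordellWeilRank_add_holds`) — so the S3 leaf's statement holds on this family from Zhai ALONE (no Kato, no
GZK, no modularity binder: `L ≠ 0 ⇒ r_an = 0` is unconditional). The twists have conductor `p·q²` (additive at `q`), good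
ordinary at `2`; they are NOT of prime conductor, so this family is disjoint from Mazur's.

* `analyticRank_eq_zero_and_selmerCorank_two_eq_zero_of_zhai14` — `r_an = 0 ∧ corank₂ = 0` on the family;
* `twoConverse_le_one_on_neumannSetzerTwists_of_zhai14` — the leaf's shape `∀ r ≤ 1, corank₂ = r → r_an = r` there.

HONEST FRAMING: bookkeeping from a typed printed theorem; the S3 items stay OPEN; nothing booked (D-0054); BSD is not
proved by any of this. PARTITION (D-0054): none — RANK axis (S3) × X5@2 good-ordinary (β) rows «NS twisted by −q»
(conductor `(u²+64)·q²`); types-the-object-of. References: [Zhai2016] Thm. 1.4, §4 (Cor. 4.3–4.6, Thms. 4.9–4.10);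
[GreenbergLNM1716] §1.
-/

set_option linter.dupNamespace false
set_option autoImplicit false

noncomputable section

open scoped Classical
open WeierstrassCurve Literature.NumberTheory.EllipticCurves Literature.NumberTheory.EllipticCurves.Zhai2016

namespace Summit.BirchSwinnertonDyer.BirchSwinnertonDyer.Theorems.TwoAdicPrimeConductor

/-- **Zhai's Neumann–Setzer twists lie in the `r_an = 0` locus with `corank_{ℤ₂} Sel_{2^∞} = 0`.** For `u ≡ 5 (mod 8)`,
`p = u² + 64` prime, `q ≡ 3 (mod 4)` a prime inert in `ℚ(√p)`, and `WM` a globally minimal model of `A^{(−q)}`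
(`A = Zhai2016.neumannSetzer u`): `ord_{s=1} L(WM,s) = 0` and `corank_{ℤ₂} Sel_{2^∞}(WM/ℚ) = 0` — from Zhai's Thm. 1.4
(`L(WM,1) ≠ 0`, `WM(ℚ)` finite, `Ш(WM)` finite) and the corank identity `corank = rank + corank Ш[2^∞]`.
[cite: Zhai2016, Thm. 1.4 (arXiv:1409.0231 chunk p0003 L60–L75)] [cite: GreenbergLNM1716, §1 pp. 54–57] -/
theorem analyticRank_eq_zero_and_selmerCorank_two_eq_zero_of_zhai14 (hZ : thm14_neumannSetzer_twists)
    {u : ℤ} (hu : u % 8 = 5) (hp : (u ^ 2 + 64).natAbs.Prime) {q : ℕ} (hq : q.Prime) (hq4 : q % 4 = 3)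
    (hinert : CaiLiZhai2019.IsInertIn q (u ^ 2 + 64)) (WM : WeierstrassCurve ℚ) [WM.IsElliptic] [WM.IsGloballyMinimal]
    (hWM : ∃ C : VariableChange ℚ, C • (neumannSetzer u).quadraticTwist (-(q : ℚ)) = WM) :
    WM.analyticRank = 0 ∧ WM.selmerCorank 2 = 0 := by
  obtain ⟨-, hL, hfinPt, hfinSha, -, -⟩ := hZ u hu hp q hq hq4 hinert WM hWM
  refine ⟨Literature.NumberTheory.EllipticCurves.analyticRank_eq_zero_of_entireLFunction_one_ne_zero WM hL, ?_⟩
  haveI := hfinSha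
  rw [WM.selmerCorank_eq_mordellWeilRank_add_holds 2,
    Literature.NumberTheory.EllipticCurves.mordellWeilRank_eq_zero_of_finite WM hfinPt,
    WM.shaCorank_eq_zero_of_finite 2]

/-- **The S3 leaf's statement on Zhai's Neumann–Setzer twists, from Zhai's Thm. 1.4 alone**: for `WM` as above and
`r ≤ 1`, `corank_{ℤ₂} Sel_{2^∞}(WM) = r ⇒ ord_{s=1} L(WM,s) = r` (both sides are `0`; `r = 1` is vacuous). No Kato, no
GZK, no modularity binder. [cite: Zhai2016, Thm. 1.4 (arXiv:1409.0231 chunk p0003 L60–L75)] -/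
theorem twoConverse_le_one_on_neumannSetzerTwists_of_zhai14 (hZ : thm14_neumannSetzer_twists)
    {u : ℤ} (hu : u % 8 = 5) (hp : (u ^ 2 + 64).natAbs.Prime) {q : ℕ} (hq : q.Prime) (hq4 : q % 4 = 3)
    (hinert : CaiLiZhai2019.IsInertIn q (u ^ 2 + 64)) (WM : WeierstrassCurve ℚ) [WM.IsElliptic] [WM.IsGloballyMinimal]
    (hWM : ∃ C : VariableChange ℚ, C • (neumannSetzer u).quadraticTwist (-(q : ℚ)) = WM) :
    ∀ r : ℕ, r ≤ 1 → WM.selmerCorank 2 = r → WM.analyticRank = r := by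
  intro r _ hr
  obtain ⟨hra, hs⟩ := analyticRank_eq_zero_and_selmerCorank_two_eq_zero_of_zhai14 hZ hu hp hq hq4 hinert WM hWM
  omega

/-- **Item 19218's conclusion on Zhai's family**: `r_an(WM) = 0` for every globally minimal model of `A^{(−q)}` as above
(the converse's hypothesis `corank = 0` also holds there, by the previous theorem). [cite: Zhai2016, Thm. 1.4 (arXiv:1409.0231 chunk p0003 L60–L75)] -/
theorem analyticRank_eq_zero_on_neumannSetzerTwists_of_zhai14 (hZ : thm14_neumannSetzer_twists)
    {u : ℤ} (hu : u % 8 = 5) (hp : (u ^ 2 + 64).natAbs.Prime) {q : ℕ} (hq : q.Prime) (hq4 : q % 4 = 3)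
    (hinert : CaiLiZhai2019.IsInertIn q (u ^ 2 + 64)) (WM : WeierstrassCurve ℚ) [WM.IsElliptic] [WM.IsGloballyMinimal]
    (hWM : ∃ C : VariableChange ℚ, C • (neumannSetzer u).quadraticTwist (-(q : ℚ)) = WM) : WM.analyticRank = 0 :=
  (analyticRank_eq_zero_and_selmerCorank_two_eq_zero_of_zhai14 hZ hu hp hq hq4 hinert WM hWM).1

end Summit.BirchSwinnertonDyer.BirchSwinnertonDyer.Theorems.TwoAdicPrimeConductor

end
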